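import Summits.Parity.GeneralizedHardyLittlewood.Theses.LiouvilleShiftedTables

/-!
# `PairsHL`: pointwise bounds for the correlation sum `∑_{n ≤ N} Λ(n)Λ(n+h)`

Route `LiouvilleShiftedTables` (Parity / GeneralizedHardyLittlewood), support item stmt-Parity-9387
(`Summit.Parity.GeneralizedHardyLittlewood.Theses.LiouvilleShiftedTables.PairsHL`):
for every `h ≥ 1`, `∑_{n ≤ N} Λ(n) Λ(n+h) = 𝔖({0,h}) N + o(N)`.

This file proves the finite-`N` inequalities relating the `Λ`-weighted sum to the prime-pair count
`π_{{0,h}}(N) = #{n ≤ N : n, n+h prime}` (used by `…PairsHLStatus` in both directions):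

* `primeTupleCount_pair` — `Literature.NumberTheory.Sieve.primeTupleCount {0,h} N = π_{{0,h}}(N)`;
* `sum_bothPrime_le`, `sub_mul_log_sq_le_sum_bothPrime` — the prime-pair part
  `S₁(N) = ∑_{p ≤ N, p, p+h prime} log p · log(p+h)` satisfies
  `(π_h(N) − M) log²(M+1) ≤ S₁(N) ≤ π_h(N) log N log(N+h)` for every `M`;
* `sum_not_bothPrime_le` — the remaining terms (a proper prime power at `n` or `n+h`) contribute
  `≤ 2 (√(N+h) + 1)(log₂(N+h) + 1) log²(N+h)`;
* `abs_sub_le_of_bounds`, `abs_count_sub_le_of_bounds` — the real-inequality skeletons of the two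
  directions `π-asymptotic ⇒ Λ-asymptotic` and `Λ-asymptotic ⇒ π-asymptotic`.
-/

open Finset Filter Asymptotics ArithmeticFunction

noncomputable section

namespace Summit.Parity.GeneralizedHardyLittlewood.Theorems.PairsHL

open Literature.NumberTheory.Sieve
open Summit.Parity.GeneralizedHardyLittlewood.Theses.LiouvilleShiftedTables (PairsHL)

/-! ### The pair-counting function -/

/-- `π_{{0,h}}(x) = #{1 ≤ n ≤ x : n and n + h prime}`. [folklore] -/
theorem primeTupleCount_pair (h x : ℕ) :
    primeTupleCount ({0, (h : ℤ)} : Finset ℤ) x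
      = #((Icc 1 x).filter fun n ↦ n.Prime ∧ (n + h).Prime) := by
  unfold primeTupleCount
  congr 1
  refine filter_congr fun n hn ↦ ?_
  have hn1 : 1 ≤ n := (mem_Icc.mp hn).1
  have e : ((n : ℤ) + (h : ℤ)).toNat = n + h := by rw [← Nat.cast_add, Int.toNat_natCast]
  have e0 : ((n : ℤ) + 0).toNat = n := by rw [add_zero, Int.toNat_natCast]
  simp only [mem_insert, mem_singleton, forall_eq_or_imp, forall_eq, e, e0]
  constructor
  · rintro ⟨⟨-, h1⟩, -, h2⟩
    exact ⟨h1, h2⟩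
  · rintro ⟨h1, h2⟩
    exact ⟨⟨by exact_mod_cast (by omega : 0 < n), h1⟩,
      by exact_mod_cast (by omega : 0 < n + h), h2⟩

/-! ### The prime-pair part `S₁` -/

/-- Upper bound for the prime-pair part:
`∑_{n ≤ N, n & n+h prime} Λ(n)Λ(n+h) ≤ π_{{0,h}}(N) · log N · log(N+h)`. [folklore] -/
theorem sum_bothPrime_le (h N : ℕ) :
    ∑ n ∈ (Icc 1 N).filter (fun n ↦ n.Prime ∧ (n + h).Prime),
        vonMangoldt n * vonMangoldt (n + h)
      ≤ #((Icc 1 N).filter fun n ↦ n.Prime ∧ (n + h).Prime)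
          * (Real.log N * Real.log ((N + h : ℕ) : ℝ)) := by
  rw [← nsmul_eq_mul, ← sum_const]
  refine sum_le_sum fun n hn ↦ ?_
  rw [mem_filter, mem_Icc] at hn
  obtain ⟨⟨hn1, hnN⟩, hp, hq⟩ := hn
  rw [vonMangoldt_apply_prime hp, vonMangoldt_apply_prime hq]
  have h1 : Real.log n ≤ Real.log N :=
    Real.log_le_log (by exact_mod_cast hn1) (by exact_mod_cast hnN)
  have h2 : Real.log ((n + h : ℕ) : ℝ) ≤ Real.log ((N + h : ℕ) : ℝ) :=
    Real.log_le_log (by exact_mod_cast (by omega : 0 < n + h))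
      (by exact_mod_cast (by omega : n + h ≤ N + h))
  exact mul_le_mul h1 h2 (Real.log_natCast_nonneg _) (Real.log_natCast_nonneg _)

/-- Lower bound for the prime-pair part: for every `M`,
`(π_{{0,h}}(N) − M) · log²(M+1) ≤ ∑_{n ≤ N, n & n+h prime} Λ(n)Λ(n+h)` (drop the `n ≤ M`, at most
`M` of them, and use `log n, log(n+h) ≥ log(M+1)` for the others). [folklore] -/
theorem sub_mul_log_sq_le_sum_bothPrime (h N M : ℕ) :
    ((#((Icc 1 N).filter fun n ↦ n.Prime ∧ (n + h).Prime) : ℝ) - M)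
        * Real.log ((M + 1 : ℕ) : ℝ) ^ 2
      ≤ ∑ n ∈ (Icc 1 N).filter (fun n ↦ n.Prime ∧ (n + h).Prime),
          vonMangoldt n * vonMangoldt (n + h) := by
  set P := (Icc 1 N).filter (fun n ↦ n.Prime ∧ (n + h).Prime) with hP
  set LM := Real.log ((M + 1 : ℕ) : ℝ) with hLM
  have hLM0 : 0 ≤ LM := Real.log_natCast_nonneg _
  have hcardN : #P ≤ #(P.filter fun n ↦ M < n) + M := by
    calc #P = #(P.filter fun n ↦ M < n) + #(P.filter fun n ↦ ¬ M < n) :=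
          (card_filter_add_card_filter_not _).symm
      _ ≤ #(P.filter fun n ↦ M < n) + #(Icc 1 M) := by
          gcongr #(P.filter fun n ↦ M < n) + #?_
          intro n hn
          rw [mem_filter, hP, mem_filter, mem_Icc] at hn
          rw [mem_Icc]
          omega
      _ = #(P.filter fun n ↦ M < n) + M := by rw [Nat.card_Icc, Nat.add_sub_cancel]
  have hcard : (#P : ℝ) - M ≤ #(P.filter fun n ↦ M < n) := by
    have : (#P : ℝ) ≤ #(P.filter fun n ↦ M < n) + M := by exact_mod_cast hcardN
    linarith
  calc ((#P : ℝ) - M) * LM ^ 2 ≤ #(P.filter fun n ↦ M < n) * LM ^ 2 := by gcongr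
    _ = ∑ _n ∈ P.filter (fun n ↦ M < n), LM ^ 2 := by rw [sum_const, nsmul_eq_mul]
    _ ≤ ∑ n ∈ P.filter (fun n ↦ M < n), vonMangoldt n * vonMangoldt (n + h) := by
        refine sum_le_sum fun n hn ↦ ?_
        rw [mem_filter, hP, mem_filter] at hn
        obtain ⟨⟨-, hp, hq⟩, hMn⟩ := hn
        rw [vonMangoldt_apply_prime hp, vonMangoldt_apply_prime hq, sq]
        have h1 : LM ≤ Real.log n :=
          Real.log_le_log (by exact_mod_cast (by omega : 0 < M + 1))
            (by exact_mod_cast (by omega : M + 1 ≤ n))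
        have h2 : LM ≤ Real.log ((n + h : ℕ) : ℝ) :=
          Real.log_le_log (by exact_mod_cast (by omega : 0 < M + 1))
            (by exact_mod_cast (by omega : M + 1 ≤ n + h))
        exact mul_le_mul h1 h2 hLM0 (Real.log_natCast_nonneg _)
    _ ≤ ∑ n ∈ P, vonMangoldt n * vonMangoldt (n + h) :=
        sum_le_sum_of_subset_of_nonneg (filter_subset _ _)
          fun _ _ _ ↦ mul_nonneg vonMangoldt_nonneg vonMangoldt_nonneg

/-! ### The proper-prime-power part `S₂` -/

/-- A prime power `m ≤ M` which is not a prime is `p^k` with `p ≤ √M` and `2 ≤ k ≤ log₂ M`.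
[folklore] -/
theorem mem_image_pow_of_isPrimePow {m M : ℕ} (hm : IsPrimePow m) (hp : ¬ m.Prime) (hM : m ≤ M) :
    m ∈ ((range (Nat.sqrt M + 1)) ×ˢ (range (Nat.log 2 M + 1))).image
      fun pk : ℕ × ℕ ↦ pk.1 ^ pk.2 := by
  obtain ⟨p, k, hpp, hk, rfl⟩ := (isPrimePow_nat_iff _).mp hm
  have hk2 : 2 ≤ k := by
    by_contra hlt
    obtain rfl : k = 1 := by omega
    rw [pow_one] at hp
    exact hp hpp
  have hpM : p ≤ Nat.sqrt M := by
    rw [Nat.le_sqrt']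
    exact (Nat.pow_le_pow_right hpp.pos hk2).trans hM
  have hkM : k ≤ Nat.log 2 M :=
    Nat.le_log_of_pow_le one_lt_two ((Nat.pow_le_pow_left hpp.two_le k).trans hM)
  exact mem_image.mpr ⟨(p, k), mem_product.mpr
    ⟨mem_range.mpr (Nat.lt_succ_of_le hpM), mem_range.mpr (Nat.lt_succ_of_le hkM)⟩, rfl⟩

/-- The terms of `∑_{n ≤ N} Λ(n)Λ(n+h)` at which `n` and `n + h` are NOT both prime contribute at
most `2 (√(N+h) + 1)(log₂(N+h) + 1) · log²(N+h)`: a non-zero such term has a proper prime power at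
`n` or at `n + h`, and there are at most `(√(N+h) + 1)(log₂(N+h) + 1)` proper prime powers
`≤ N + h`. [folklore] -/
theorem sum_not_bothPrime_le (h N : ℕ) :
    ∑ n ∈ (Icc 1 N).filter (fun n ↦ ¬ (n.Prime ∧ (n + h).Prime)),
        vonMangoldt n * vonMangoldt (n + h)
      ≤ 2 * ((Nat.sqrt (N + h) + 1) * (Nat.log 2 (N + h) + 1))
          * Real.log ((N + h : ℕ) : ℝ) ^ 2 := by
  set L := Real.log ((N + h : ℕ) : ℝ) with hLdef
  have hL : 0 ≤ L := Real.log_natCast_nonneg _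
  set T := ((range (Nat.sqrt (N + h) + 1)) ×ˢ (range (Nat.log 2 (N + h) + 1))).image
    fun pk : ℕ × ℕ ↦ pk.1 ^ pk.2 with hT
  have hTcard : #T ≤ (Nat.sqrt (N + h) + 1) * (Nat.log 2 (N + h) + 1) :=
    card_image_le.trans (by rw [card_product, card_range, card_range])
  set s := ((Icc 1 N).filter (fun n ↦ ¬ (n.Prime ∧ (n + h).Prime))).filter
    fun n ↦ vonMangoldt n * vonMangoldt (n + h) ≠ 0 with hs
  have hsum : ∑ n ∈ (Icc 1 N).filter (fun n ↦ ¬ (n.Prime ∧ (n + h).Prime)),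
        vonMangoldt n * vonMangoldt (n + h)
      = ∑ n ∈ s, vonMangoldt n * vonMangoldt (n + h) := (sum_filter_ne_zero _).symm
  have hterm : ∀ n ∈ s, vonMangoldt n * vonMangoldt (n + h) ≤ L ^ 2 := by
    intro n hn
    have hn' := mem_Icc.mp (mem_filter.mp (mem_filter.mp hn).1).1
    have hn0 : (0 : ℝ) < n := by exact_mod_cast hn'.1
    have hnN : (n : ℝ) ≤ ((N + h : ℕ) : ℝ) := by exact_mod_cast (by omega : n ≤ N + h)
    have hnh0 : (0 : ℝ) < ((n + h : ℕ) : ℝ) := by exact_mod_cast (by omega : 0 < n + h)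
    have hnhN : ((n + h : ℕ) : ℝ) ≤ ((N + h : ℕ) : ℝ) := by
      exact_mod_cast (by omega : n + h ≤ N + h)
    have h1 : vonMangoldt n ≤ L := vonMangoldt_le_log.trans (Real.log_le_log hn0 hnN)
    have h2 : vonMangoldt (n + h) ≤ L := vonMangoldt_le_log.trans (Real.log_le_log hnh0 hnhN)
    calc vonMangoldt n * vonMangoldt (n + h) ≤ L * L := mul_le_mul h1 h2 vonMangoldt_nonneg hL
      _ = L ^ 2 := (sq L).symm
  have hsub : s ⊆ T ∪ T.image (· - h) := by
    intro n hn
    rw [mem_filter, mem_filter, mem_Icc] at hn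
    obtain ⟨⟨⟨-, hnN⟩, hnot⟩, hne⟩ := hn
    have h1 : IsPrimePow n := vonMangoldt_ne_zero_iff.mp (left_ne_zero_of_mul hne)
    have h2 : IsPrimePow (n + h) := vonMangoldt_ne_zero_iff.mp (right_ne_zero_of_mul hne)
    rw [mem_union]
    by_cases hp : n.Prime
    · have hq : ¬ (n + h).Prime := fun hq ↦ hnot ⟨hp, hq⟩
      exact Or.inr (mem_image.mpr
        ⟨n + h, mem_image_pow_of_isPrimePow h2 hq (Nat.add_le_add_right hnN h), by simp⟩)
    · exact Or.inl (mem_image_pow_of_isPrimePow h1 hp (by omega))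
  have hcard : #s ≤ 2 * ((Nat.sqrt (N + h) + 1) * (Nat.log 2 (N + h) + 1)) :=
    calc #s ≤ #(T ∪ T.image (· - h)) := card_le_card hsub
      _ ≤ #T + #(T.image (· - h)) := card_union_le _ _
      _ ≤ #T + #T := Nat.add_le_add_left card_image_le _
      _ ≤ 2 * ((Nat.sqrt (N + h) + 1) * (Nat.log 2 (N + h) + 1)) := by omega
  have hcardR : (#s : ℝ) ≤ 2 * ((Nat.sqrt (N + h) + 1) * (Nat.log 2 (N + h) + 1)) := by
    exact_mod_cast hcard
  calc ∑ n ∈ (Icc 1 N).filter (fun n ↦ ¬ (n.Prime ∧ (n + h).Prime)),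
          vonMangoldt n * vonMangoldt (n + h)
        = ∑ n ∈ s, vonMangoldt n * vonMangoldt (n + h) := hsum
    _ ≤ ∑ _n ∈ s, L ^ 2 := sum_le_sum hterm
    _ = #s * L ^ 2 := by rw [sum_const, nsmul_eq_mul]
    _ ≤ 2 * ((Nat.sqrt (N + h) + 1) * (Nat.log 2 (N + h) + 1)) * L ^ 2 := by gcongr

/-! ### Real-inequality skeletons -/

/-- The real-inequality skeleton of `pairsHL_shift_of_count`: with `g = S N / LN²`,
`P ∈ [(1−δ) g, (1+δ) g]`, `S₁ ≤ P · LN · Lh`, `Lh ≤ (1+δ) LN`, `(P − M) LM² ≤ S₁`, `M ≤ X`,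
`X LN² ≤ δ N`, `(1−δ) LN ≤ LM` and `0 ≤ S₂ ≤ δ N` one gets `|S₁ + S₂ − S N| ≤ δ (3S+2) N ≤ ε N`.
[folklore] -/
theorem abs_sub_le_of_bounds {S N LN Lh LM X M P S₁ S₂ δ ε : ℝ}
    (hS0 : 0 ≤ S) (hN0 : 0 < N) (hLN : 0 < LN) (hLh0 : 0 ≤ Lh)
    (hδ0 : 0 < δ) (hδ1 : δ ≤ 1 / 2) (hδε : δ * (3 * S + 2) ≤ ε)
    (hPup : P ≤ (1 + δ) * (S * N / LN ^ 2)) (hPlo : (1 - δ) * (S * N / LN ^ 2) ≤ P)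
    (hLh : Lh ≤ (1 + δ) * LN)
    (hS₁up : S₁ ≤ P * (LN * Lh)) (hS₁lo : (P - M) * LM ^ 2 ≤ S₁) (hS₁0 : 0 ≤ S₁)
    (hS₂0 : 0 ≤ S₂) (hS₂up : S₂ ≤ δ * N)
    (hMX : M ≤ X) (hX0 : 0 ≤ X) (hX : X * LN ^ 2 ≤ δ * N) (hLM : (1 - δ) * LN ≤ LM) :
    |S₁ + S₂ - S * N| ≤ ε * N := by
  set g := S * N / LN ^ 2 with hg
  have hg0 : 0 ≤ g := by positivity
  have hgS : g * LN ^ 2 = S * N := by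
    rw [hg]
    field_simp
  have hSN : 0 ≤ S * N := by positivity
  have hδN : 0 ≤ δ * N := by positivity
  have hδA : (1 + δ) ^ 2 - 1 ≤ 3 * δ := by nlinarith
  have hδB : 1 - (1 - δ) ^ 3 ≤ 3 * δ := by nlinarith
  have hδC : (1 - δ) ^ 3 ≤ 1 - δ := by nlinarith
  have hδD : (1 - δ) ^ 2 ≤ 1 := by nlinarith
  have hδE : 0 ≤ 1 - δ := by linarith
  have hLM0 : 0 ≤ (1 - δ) * LN := mul_nonneg hδE hLN.le
  have h1g : 0 ≤ (1 + δ) * g := by positivity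
  -- upper bound for the prime-pair part
  have hup : S₁ ≤ (1 + δ) ^ 2 * (S * N) := by
    calc S₁ ≤ P * (LN * Lh) := hS₁up
      _ ≤ ((1 + δ) * g) * (LN * ((1 + δ) * LN)) := by gcongr
      _ = (1 + δ) ^ 2 * (g * LN ^ 2) := by ring
      _ = (1 + δ) ^ 2 * (S * N) := by rw [hgS]
  -- lower bound for the prime-pair part
  have hlo : (1 - δ) ^ 3 * (S * N) - δ * N ≤ S₁ := by
    rcases le_or_gt M P with hPM | hPM
    · have hPM' : 0 ≤ P - M := by linarith
      calc (1 - δ) ^ 3 * (S * N) - δ * N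
            ≤ (1 - δ) ^ 3 * (S * N) - (1 - δ) ^ 2 * (X * LN ^ 2) := by
              have : (1 - δ) ^ 2 * (X * LN ^ 2) ≤ X * LN ^ 2 :=
                mul_le_of_le_one_left (by positivity) hδD
              linarith
        _ = ((1 - δ) * g - X) * ((1 - δ) * LN) ^ 2 := by
              rw [← hgS]
              ring
        _ ≤ (P - M) * ((1 - δ) * LN) ^ 2 := by
              gcongr ?_ * _
              linarith
        _ ≤ (P - M) * LM ^ 2 := by gcongr
        _ ≤ S₁ := hS₁lo
    · have h1 : (1 - δ) * (S * N) ≤ δ * N := by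
        calc (1 - δ) * (S * N) = ((1 - δ) * g) * LN ^ 2 := by
              rw [← hgS]
              ring
          _ ≤ X * LN ^ 2 := by
              gcongr
              linarith
          _ ≤ δ * N := hX
      have h2 : (1 - δ) ^ 3 * (S * N) ≤ (1 - δ) * (S * N) :=
        mul_le_mul_of_nonneg_right hδC hSN
      linarith
  have hF1 : (1 - (1 - δ) ^ 3) * (S * N) ≤ 3 * δ * (S * N) :=
    mul_le_mul_of_nonneg_right hδB hSN
  have hF2 : ((1 + δ) ^ 2 - 1) * (S * N) ≤ 3 * δ * (S * N) :=
    mul_le_mul_of_nonneg_right hδA hSN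
  have hδεN : δ * (3 * S + 2) * N ≤ ε * N := mul_le_mul_of_nonneg_right hδε hN0.le
  rw [abs_le]
  constructor
  · linarith
  · linarith

/-- The real-inequality skeleton of `count_of_pairsHL_shift`: with `T = S₁ + S₂`,
`|T − S N| ≤ δ N`, `S₁ ≤ P LN Lh`, `Lh ≤ (1+δ) LN`, `(P − M) LM² ≤ S₁`, `(1−δ) LN ≤ LM`,
`0 ≤ S₂ ≤ δ N`, `0 ≤ M ≤ X`, `X LN² ≤ δ N` and `δ (8S + 10) ≤ ε S` one gets
`|P − S N / LN²| ≤ ε S N / LN²`. [folklore] -/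
theorem abs_count_sub_le_of_bounds {S N LN Lh LM X M P S₁ S₂ T δ ε : ℝ}
    (hS : 0 < S) (hN0 : 0 < N) (hLN : 0 < LN)
    (hδ0 : 0 < δ) (hδ1 : δ ≤ 1 / 2) (hδε : δ * (8 * S + 10) ≤ ε * S)
    (hT : |T - S * N| ≤ δ * N) (hTsplit : T = S₁ + S₂)
    (hS₁up : S₁ ≤ P * (LN * Lh)) (hLh : Lh ≤ (1 + δ) * LN)
    (hS₁lo : (P - M) * LM ^ 2 ≤ S₁) (hLM : (1 - δ) * LN ≤ LM)
    (hS₂0 : 0 ≤ S₂) (hS₂up : S₂ ≤ δ * N)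
    (hP0 : 0 ≤ P) (hM0 : 0 ≤ M) (hMX : M ≤ X) (hX : X * LN ^ 2 ≤ δ * N) :
    |P - S * N / LN ^ 2| ≤ ε * (S * N / LN ^ 2) := by
  have hSN : 0 ≤ S * N := by positivity
  have hδN : 0 ≤ δ * N := by positivity
  have hδSN : 0 ≤ δ * (S * N) := by positivity
  have hLN2 : 0 < LN ^ 2 := by positivity
  have hPL0 : 0 ≤ P * LN ^ 2 := by positivity
  have hδD : (1 - δ) ^ 2 ≤ 1 := by nlinarith
  have hδE : 0 ≤ 1 - δ := by linarith
  have hLM0 : 0 ≤ (1 - δ) * LN := mul_nonneg hδE hLN.le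
  obtain ⟨hT1, hT2⟩ := abs_le.mp hT
  have hS₁T : S₁ ≤ T := by linarith
  -- (A) `P (1-δ)² LN² ≤ (S + 2δ) N`
  have hA : P * ((1 - δ) * LN) ^ 2 ≤ (S + 2 * δ) * N := by
    rcases le_or_gt M P with hPM | hPM
    · have hPM' : 0 ≤ P - M := by linarith
      have h1 : (P - M) * ((1 - δ) * LN) ^ 2 ≤ (S + δ) * N := by
        calc (P - M) * ((1 - δ) * LN) ^ 2 ≤ (P - M) * LM ^ 2 := by gcongr
          _ ≤ S₁ := hS₁lo
          _ ≤ T := hS₁T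
          _ ≤ (S + δ) * N := by linarith
      have h2 : M * ((1 - δ) * LN) ^ 2 ≤ δ * N := by
        calc M * ((1 - δ) * LN) ^ 2 = (1 - δ) ^ 2 * (M * LN ^ 2) := by ring
          _ ≤ M * LN ^ 2 := mul_le_of_le_one_left (by positivity) hδD
          _ ≤ X * LN ^ 2 := by gcongr
          _ ≤ δ * N := hX
      have e : P * ((1 - δ) * LN) ^ 2
          = (P - M) * ((1 - δ) * LN) ^ 2 + M * ((1 - δ) * LN) ^ 2 := by ring
      rw [e]
      linarith
    · calc P * ((1 - δ) * LN) ^ 2 = (1 - δ) ^ 2 * (P * LN ^ 2) := by ring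
        _ ≤ P * LN ^ 2 := mul_le_of_le_one_left hPL0 hδD
        _ ≤ M * LN ^ 2 := by gcongr
        _ ≤ X * LN ^ 2 := by gcongr
        _ ≤ δ * N := hX
        _ ≤ (S + 2 * δ) * N := by nlinarith
  -- (B) a crude bound `P LN² ≤ 4 S N + 8 δ N`
  have hB : P * LN ^ 2 ≤ 4 * (S * N) + 8 * (δ * N) := by
    have hq : 1 / 4 ≤ (1 - δ) ^ 2 := by nlinarith
    have : 1 / 4 * (P * LN ^ 2) ≤ P * ((1 - δ) * LN) ^ 2 := by
      calc 1 / 4 * (P * LN ^ 2) ≤ (1 - δ) ^ 2 * (P * LN ^ 2) := by gcongr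
        _ = P * ((1 - δ) * LN) ^ 2 := by ring
    nlinarith
  have hB' : δ * (P * LN ^ 2) ≤ δ * (4 * (S * N) + 8 * (δ * N)) :=
    mul_le_mul_of_nonneg_left hB hδ0.le
  have hδ2N : δ * (δ * N) ≤ 1 / 2 * (δ * N) := mul_le_mul_of_nonneg_right hδ1 hδN
  have hδεN : δ * (8 * S + 10) * N ≤ ε * S * N := mul_le_mul_of_nonneg_right hδε hN0.le
  have hδ2Q : 0 ≤ δ ^ 2 * (P * LN ^ 2) := by positivity
  -- (C) the two-sided bound for `P LN²`
  have hupper : P * LN ^ 2 ≤ (1 + ε) * (S * N) := by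
    have e : P * ((1 - δ) * LN) ^ 2
        = P * LN ^ 2 - 2 * (δ * (P * LN ^ 2)) + δ ^ 2 * (P * LN ^ 2) := by ring
    rw [e] at hA
    nlinarith
  have hlower : (1 - ε) * (S * N) ≤ P * LN ^ 2 := by
    have h1 : S₁ ≤ (1 + δ) * (P * LN ^ 2) := by
      calc S₁ ≤ P * (LN * Lh) := hS₁up
        _ ≤ P * (LN * ((1 + δ) * LN)) := by gcongr
        _ = (1 + δ) * (P * LN ^ 2) := by ring
    have h2 : (S - 2 * δ) * N ≤ S₁ := by nlinarith
    nlinarith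
  have key : |P * LN ^ 2 - S * N| ≤ ε * (S * N) := abs_le.mpr ⟨by linarith, by linarith⟩
  have e : P - S * N / LN ^ 2 = (P * LN ^ 2 - S * N) / LN ^ 2 := by
    field_simp
  calc |P - S * N / LN ^ 2| = |P * LN ^ 2 - S * N| / LN ^ 2 := by
        rw [e, abs_div, abs_of_pos hLN2]
    _ ≤ ε * (S * N) / LN ^ 2 := by gcongr
    _ = ε * (S * N / LN ^ 2) := by ring

end Summit.Parity.GeneralizedHardyLittlewood.Theorems.PairsHL

end
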